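import Summits.HodgeConjecture.HodgeConjecture.Theorems.F0P3HodgeTypeRigidOfBetaOppAdmCot   -- ★ (g7-1) p820124: the `h2` edition; same imports ∕ opens ∕ lemmas
import Summits.HodgeConjecture.HodgeConjecture.Theorems.F0P3ThreadLetters3Defs          -- ★ the letter text `HodgeTypeRigid₃` (S5-R20: ONE home, BY NAME)
import HarnessLib

/-!
# Crux `H413` — rung 4 glue, TWO-COMPACT-PLACE TWIN (R90-TF THREAD-₃ lane 2, file (E-3a)): letter E2′₃ `HodgeTypeRigid₃` from the
# COTANGENT-GUARDED β_opp-adm at frames with two compact places + `StubF1aCM` — `hodgeTypeRigid_of_betaOppAdmCot_cpt₃`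

F0∕P3 «U3-mult», cell `hodgecm-mathlib`, crux H413 (`stmt-HodgeConjecture-24833`); R90-TF slab S5 seat R90-C133-p03 (g4), deal (H25) → E-3 (S5 dealer
R90-C133-plan (g3) 2026-09-05T03:00:09Z ∕ 03:02:55Z); census `R90/R90-C133-p01/g2/CENSUS-L7.md` 9974659a §3 (E-3); heir LEAD F0P3a-plan (g22) RULING (R-44)
(C)(7); director (g40) s2043 (c)(ii)(iii); RULING S5-R19 «₃ twins live Summits-side»; RULING S5-R20 «ONE TEXT HOME, TWO LANES» (letter texts BY NAME from ★
`F0P3ThreadLetters3Defs`).  PROOF lane (theorems only; no `def`, no instance, no notation, no `sorry`); ADDITIVE (a new module beside ★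
`F0P3HodgeTypeRigidOfBetaOppAdmCot`, which is untouched and imported for its imports and lemmas); `--supports stmt-HodgeConjecture-24833 --as helper`.
HONEST LABEL: this file pays nothing until AGG's ₃ edition consumes it; HC_CM is proved only modulo the 7 printed citations (2 remaining named inputs:
hLiu418 = stmt-HodgeConjecture-24832, h413 = stmt-HodgeConjecture-24833) until rung 0 closes.

WHY A TWIN.  The R90-TF road pays letter #80's finite-place organ from the Arthur-simple trace formula, which needs TWO compact real places of the definite
unitary group (`3 ≤ [L⁺:ℚ]`); AGG (`Lines/F0_U3LettersRung1.lean`) DERIVES E1_coh ∕ E2′ from the rung-0 rows (:651 ★ `letters_of_specPkgV8W_cot`), so with ₃ rows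
the V8 engine chain (E-2) `shapeGuarded₃_of_T5` → (E-3) `letters_of_guardedEngine₃` → (E-1) `letters_of_specPkgV8W_cot₃` must run in the ₃ currency; this file is the
E2′ step of (E-3): β_opp-adm-cot₃ (the cotangent-guarded β_opp-adm text at `h2 h3` frames) + F1a ⇒ `HodgeTypeRigid₃`.

WHAT CHANGES w.r.t. ★ `F0P3HodgeTypeRigidOfBetaOppAdmCot.hodgeTypeRigid_of_betaOppAdmCot_cpt` (everything else VERBATIM): `hβc` ↦ the β_opp-adm-cot text with ONE
inserted line `3 ≤ Module.finrank ℚ ↥(maximalRealSubfield L) →` after the kept `2 ≤ …` line (= the `.2` text of ★ `F0P3GuardedLettersOfGuardedShape3.stubs_of_guardedEngine₃`,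
token for token); conclusion ↦ ★ `F0P3ThreadLetters3Defs.HodgeTypeRigid₃` (Literature `Rogawski1990.hodgeTypeRigid` body + the same ONE line) BY NAME; the proof
introduces `h3` beside `h2` and passes `hdef h2 h3` at the ONE application of `hβc` (★ :149); `hF1a` = `StubF1aCM` (v5 text VERBATIM, ★-proved `stubF1aCM_holds` at
every `h2` frame) is fed `hdef h2` as before; the admissibility input ★ `isAdmissible_of_hasFinComponent_of_isHolCotangentAt_cpt` and the value maps ★ `hVal_hol` ∕
`hVal_antihol` stay `h2`.  PRINT-FAITHFULNESS (director s2043 (iii)): «`3 ≤ [F⁺:ℚ]` is implied by Hyp413 (`6 ≤ [F:ℚ]`); the weakening costs nothing at the summit;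
anchor [Rogawski1990 §13.3 (13.3.6(c)), two compact places]» — the `3 ≤` clause is a ROUTE restriction of the R90-TF road, not a hypothesis of Rogawski's theorems.
References: as in ★ `F0P3HodgeTypeRigidOfBetaOppAdmCot` ([Rogawski1990] Thm. 13.3.6 (c), Thm. 13.3.5, Thm. 14.6.4 (proof, l. 1), §12.3 p. 178, Prop. 15.2.1 (b),
§15.3 ¶1; [BernsteinZelevinsky1976] §2.1; [BorelWallach2000] VI 4.11; [FlathCorvallis1979] Thm. 3).
-/

-- Mathlib idiom (as in ★ `GKModules`, ★ K1, ★ K1″, ★ B0): commutator bracket on `Module.End ℂ M`, to MENTION `(uFormGroup (Fin 2) (Fin 1)).lie →ₗ⁅ℝ⁆ Module.End ℂ M`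
attribute [local instance 100] LieRing.ofAssociativeRing

set_option autoImplicit false
-- the mandated namespace repeats `HodgeConjecture.HodgeConjecture`, as in every `Theorems/*.lean` of this sub-problem
set_option linter.dupNamespace false

noncomputable section

namespace Summit.HodgeConjecture.HodgeConjecture.Cruxes.H413.F0P3HodgeTypeRigidOfBetaOppAdmCot3

open NumberField NumberField.InfinitePlace MeasureTheory
open scoped Matrix MatrixGroups ComplexOrder
open Literature.RepresentationTheory.BorelWallach2000
open Literature.NumberTheory.Automorphic Literature.NumberTheory.Automorphic.UnitaryGroup
open Literature.NumberTheory.Automorphic.UnitaryGroup.CotangentForms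
open Literature.RepresentationTheory.KonnoKonno2007 Literature.RepresentationTheory.KonnoKonno2007.RealDualPair
open Literature.RepresentationTheory.KonnoKonno2007.RealDualPair.UForm
open Summit.HodgeConjecture.HodgeConjecture.Cruxes.H413.F0P3HodgeTypeRigidOfArchRigid
open Summit.HodgeConjecture.HodgeConjecture.Cruxes.H413.F0P3HodgeTypeRigidDiag
open Summit.HodgeConjecture.HodgeConjecture.Cruxes.H413.F0P3ValueMapHeads
open Summit.HodgeConjecture.HodgeConjecture.Cruxes.H413.F0P3ArchIsotypyCM
open Summit.HodgeConjecture.HodgeConjecture.Cruxes.H413.F0P3ValueMapTransport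
open Summit.HodgeConjecture.HodgeConjecture.Cruxes.H413.F0P3PNullMapIsCocycle
open Summit.HodgeConjecture.HodgeConjecture.Cruxes.H413.F0P3bArchDegOnePackage
open Summit.HodgeConjecture.HodgeConjecture.Cruxes.H413.F0P3StubE2pFold
open Summit.HodgeConjecture.HodgeConjecture.Cruxes.H413.F0P3StubBetaOppAdmFold (isAdmissible_of_hasFinComponent_of_isHolCotangentAt_cpt)

/-! ## §1 E2′₃ from the COTANGENT-GUARDED β_opp-adm at frames with two compact places + F1a at the pin -/

/-- **Letter E2′₃ ★ `F0P3ThreadLetters3Defs.HodgeTypeRigid₃` from «β_opp-adm-cot₃» (the cotangent-guarded CONTRACT-v7 β_opp-adm text + ONE `3 ≤ [L⁺:ℚ]` line) and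
`StubF1aCM` in its v5 text.**  Proof = ★ `hodgeTypeRigid_of_betaOppAdmCot_cpt` token for token with `h3` introduced beside `h2` and passed at the ONE application of
`hβc`: admissibility of the common finite component read on the hol-type `P` (★ `isAdmissible_of_hasFinComponent_of_isHolCotangentAt_cpt`); F1a at the pin for `P`
(hol) and `P′` (antihol) ⇒ detecting irreducible `(𝔤, K)`-modules ★ `exists_detecting_irreducible`; the value maps ★ `hVal_hol` ∕ `hVal_antihol` composed with the
detecting maps give a type-`(+1)` class on `M` and a type-`(−1)` class on `M′` (★ J2 `typeClasses_ne_bot_of_linearMap`); β_opp-adm-cot₃ at `(P, P′)` with the guards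
`Or.inl hP`, `Or.inr hP′` closes.
[cite: Rogawski1990, Thm. 13.3.6 (c); Thm. 14.6.4 proof l. 1; §12.3 p. 178; Prop. 15.2.1 (b); §15.3 ¶1] [cite: BernsteinZelevinsky1976, §2.1]
[cite: BorelWallach2000, VI Thm. 4.11] [cite: FlathCorvallis1979, Thm. 3] -/
theorem hodgeTypeRigid_of_betaOppAdmCot_cpt₃
    (hβc :
    ∀ (L : Type) [Field L] [NumberField L] [IsCMField L] (ι : L →+* ℂ) (H : Matrix (Fin 3) (Fin 3) L) (T : GL (Fin 3) ℂ)
      (hT : (T : Matrix (Fin 3) (Fin 3) ℂ)ᴴ * H.map ι * (T : Matrix (Fin 3) (Fin 3) ℂ) = Literature.Geometry.ComplexHyperbolic.BallModel.J),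
      (∀ τ' : L →+* ℂ, InfinitePlace.mk τ' ≠ InfinitePlace.mk ι → (H.map τ').PosDef) →
      2 ≤ Module.finrank ℚ ↥(maximalRealSubfield L) →
      3 ≤ Module.finrank ℚ ↥(maximalRealSubfield L) →
      ∀ (μ : Measure (adelicGroupData (↥(maximalRealSubfield L)) L (IsCMField.complexConj L) 3 H).automorphicQuotient)
        [(adelicGroupData (↥(maximalRealSubfield L)) L (IsCMField.complexConj L) 3 H).IsAutomorphicMeasure μ]
        (W : Type) [AddCommGroup W] [Module ℂ W]
        (σ : Representation ℂ (finAdelic (↥(maximalRealSubfield L)) L (IsCMField.complexConj L) 3 H) W),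
        σ.IsIrreducible → σ.IsSmooth → σ.IsAdmissible →
      ∀ (P P' : DiscreteAutomorphicRep (adelicGroupData (↥(maximalRealSubfield L)) L (IsCMField.complexConj L) 3 H) μ),
        (P.IsHolCotangentAt (cmArchSection L ι H T hT) (cmCompactFactor L ι H T hT) ∨
          P.IsAntiholCotangentAt (cmArchSection L ι H T hT) (cmCompactFactor L ι H T hT)) →
        (P'.IsHolCotangentAt (cmArchSection L ι H T hT) (cmCompactFactor L ι H T hT) ∨
          P'.IsAntiholCotangentAt (cmArchSection L ι H T hT) (cmCompactFactor L ι H T hT)) →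
        P.HasFinComponent σ → P'.HasFinComponent σ →
      ∀ (M : Type) [AddCommGroup M] [Module ℂ M] (σK : Representation ℂ (uFormGroup (Fin 2) (Fin 1)).maximalCompact M)
        (σ𝔤 : (uFormGroup (Fin 2) (Fin 1)).lie →ₗ⁅ℝ⁆ Module.End ℂ M) (hM : IsGKModule (uFormGroup (Fin 2) (Fin 1)) σK σ𝔤),
        IsIrreducibleGK σK σ𝔤 →
        (∃ T₁ : P.archModuleCM ι T hT →ₗ[ℂ] M,
          (∀ (k : (uFormGroup (Fin 2) (Fin 1)).maximalCompact) (w : P.archModuleCM ι T hT),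
              T₁ (P.archRepKCM ι T hT k w) = σK k (T₁ w)) ∧
            (∀ (X : (uFormGroup (Fin 2) (Fin 1)).lie) (w : P.archModuleCM ι T hT),
              T₁ (P.archRepLieCM ι T hT X w) = σ𝔤 X (T₁ w)) ∧ T₁ ≠ 0) →
      ∀ (M' : Type) [AddCommGroup M'] [Module ℂ M'] (σK' : Representation ℂ (uFormGroup (Fin 2) (Fin 1)).maximalCompact M')
        (σ𝔤' : (uFormGroup (Fin 2) (Fin 1)).lie →ₗ⁅ℝ⁆ Module.End ℂ M') (hM' : IsGKModule (uFormGroup (Fin 2) (Fin 1)) σK' σ𝔤'),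
        IsIrreducibleGK σK' σ𝔤' →
        (∃ T₂ : P'.archModuleCM ι T hT →ₗ[ℂ] M',
          (∀ (k : (uFormGroup (Fin 2) (Fin 1)).maximalCompact) (w : P'.archModuleCM ι T hT),
              T₂ (P'.archRepKCM ι T hT k w) = σK' k (T₂ w)) ∧
            (∀ (X : (uFormGroup (Fin 2) (Fin 1)).lie) (w : P'.archModuleCM ι T hT),
              T₂ (P'.archRepLieCM ι T hT X w) = σ𝔤' X (T₂ w)) ∧ T₂ ≠ 0) →
        upqTypeClasses σK σ𝔤 hM.ad_compat 1 1 ≠ ⊥ → upqTypeClasses σK' σ𝔤' hM'.ad_compat 1 (-1) ≠ ⊥ → False)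
    (hF1a :
      ∀ (L : Type) [Field L] [NumberField L] [IsCMField L] (ι : L →+* ℂ) (H : Matrix (Fin 3) (Fin 3) L) (T : GL (Fin 3) ℂ)
        (hT : (T : Matrix (Fin 3) (Fin 3) ℂ)ᴴ * H.map ι * (T : Matrix (Fin 3) (Fin 3) ℂ) = Literature.Geometry.ComplexHyperbolic.BallModel.J),
        (∀ τ' : L →+* ℂ, InfinitePlace.mk τ' ≠ InfinitePlace.mk ι → (H.map τ').PosDef) →
        2 ≤ Module.finrank ℚ ↥(maximalRealSubfield L) →
        ∀ (μ : Measure (adelicGroupData (↥(maximalRealSubfield L)) L (IsCMField.complexConj L) 3 H).automorphicQuotient)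
        [(adelicGroupData (↥(maximalRealSubfield L)) L (IsCMField.complexConj L) 3 H).IsAutomorphicMeasure μ]
        (P : DiscreteAutomorphicRep (adelicGroupData (↥(maximalRealSubfield L)) L (IsCMField.complexConj L) 3 H) μ),
        (P.IsHolCotangentAt (cmArchSection L ι H T hT) (cmCompactFactor L ι H T hT) ∨
          P.IsAntiholCotangentAt (cmArchSection L ι H T hT) (cmCompactFactor L ι H T hT)) →
        P.ArchIsotypy (uFormGroup (Fin 2) (Fin 1)) (cmArchSectionUForm L ι H T hT)) :
    F0P3ThreadLetters3Defs.HodgeTypeRigid₃ := by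
  intro L _ _ _ ι H T hT hdef h2 h3 μ _ W _ _ σ hirr hsm P P' hP hP' hfin hfin'
  -- v7's extra input: the common finite component is ADMISSIBLE, read on the hol-type `P` (★ K1″ §1)
  have hadm : σ.IsAdmissible := isAdmissible_of_hasFinComponent_of_isHolCotangentAt_cpt ι T hT hdef h2 μ P hP σ hirr hsm hfin
  -- the cotangent guards of `P` (hol) and `P′` (antihol), kept for β_opp-adm-cot
  have hPc : P.IsHolCotangentAt (cmArchSection L ι H T hT) (cmCompactFactor L ι H T hT) ∨
      P.IsAntiholCotangentAt (cmArchSection L ι H T hT) (cmCompactFactor L ι H T hT) := Or.inl hP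
  have hP'c : P'.IsHolCotangentAt (cmArchSection L ι H T hT) (cmCompactFactor L ι H T hT) ∨
      P'.IsAntiholCotangentAt (cmArchSection L ι H T hT) (cmCompactFactor L ι H T hT) := Or.inr hP'
  -- letter F1a at the pin, for the hol-type `P` and the antihol-type `P′`
  have hIso := hF1a L ι H T hT hdef h2 μ P hPc
  have hIso' := hF1a L ι H T hT hdef h2 μ P' hP'c
  -- the cotangent forms and their value maps (★ B1′ heads)
  obtain ⟨Φ, hΦ, hΦ0, hcont⟩ := hP
  obtain ⟨Ψ, hΨ, hΨ0, hcont'⟩ := hP'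
  obtain ⟨φ, hφ0, h0, hK, h𝔨, hwt, hN⟩ := hVal_hol L ι H T hT hdef h2 μ P Φ hΦ hΦ0 hcont
  obtain ⟨φ', hφ'0, h0', hK', h𝔨', hwt', hN'⟩ := hVal_antihol L ι H T hT hdef h2 μ P' Ψ hΨ hΨ0 hcont'
  -- the detecting irreducible admissible modules (F1a unpacked at the pin) and detecting maps
  obtain ⟨M, _, _, σK, σ𝔤, hGK, hirrM, -, hdet⟩ := exists_detecting_irreducible ι T hT P hIso
  obtain ⟨M', _, _, σK', σ𝔤', hGK', hirrM', -, hdet'⟩ := exists_detecting_irreducible ι T hT P' hIso'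
  obtain ⟨X₀, hX₀⟩ := exists_apply_ne_zero_of_ne_zero hφ0
  obtain ⟨X₁, hX₁⟩ := exists_apply_ne_zero_of_ne_zero hφ'0
  obtain ⟨T₁, hT₁K, hT₁𝔤, hT₁⟩ := hdet _ hX₀
  obtain ⟨T₂, hT₂K, hT₂𝔤, hT₂⟩ := hdet' _ hX₁
  have hT₁0 : T₁ ≠ 0 := fun h => hT₁ (h ▸ rfl)
  have hT₂0 : T₂ ≠ 0 := fun h => hT₂ (h ▸ rfl)
  -- typed value maps on `M`, `M′` and the cohomology classes they give
  have c1 : ((1 : ℤ) : ℂ) = 1 := Int.cast_one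
  have c2 : ((-1 : ℤ) : ℂ) = -1 := by rw [Int.cast_neg, Int.cast_one]
  obtain ⟨q0, qK, q𝔨, qwt, qN⟩ := valueMap_comp (δ := 1) φ T₁ hT₁K hT₁𝔤 h0 hK h𝔨
    (fun X => eq_intCast_mul_I_smul_of_eq_one (V := ↥(P.archModuleCM ι T hT)) c1 (hwt X))
    (fun X s => add_intCast_mul_I_smul_eq_zero_of_eq_one (V := ↥(P.archModuleCM ι T hT)) c1 (hN X s))
  obtain ⟨r0, rK, r𝔨, rwt, rN⟩ := valueMap_comp (δ := -1) φ' T₂ hT₂K hT₂𝔤 h0' hK' h𝔨'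
    (fun X => eq_intCast_mul_I_smul_of_eq_neg_one (V := ↥(P'.archModuleCM ι T hT)) c2 (hwt' X))
    (fun X s => add_intCast_mul_I_smul_eq_zero_of_eq_neg_one (V := ↥(P'.archModuleCM ι T hT)) c2 (hN' X s))
  have hne : upqTypeClasses σK σ𝔤 hGK.ad_compat 1 1 ≠ ⊥ :=
    typeClasses_ne_bot_of_linearMap σK σ𝔤 hGK.ad_compat hirrM (Or.inl rfl) _
      (comp_ne_zero_of_apply_ne_zero φ T₁ hT₁) q0 qK q𝔨 qwt qN
  have hne' : upqTypeClasses σK' σ𝔤' hGK'.ad_compat 1 (-1) ≠ ⊥ :=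
    typeClasses_ne_bot_of_linearMap σK' σ𝔤' hGK'.ad_compat hirrM' (Or.inr rfl) _
      (comp_ne_zero_of_apply_ne_zero φ' T₂ hT₂) r0 rK r𝔨 rwt rN
  -- β_opp-adm-cot₃ (TWO compact places: `h2 h3`): the type-`(+1)` constituent of `P` and the type-`(−1)` constituent of `P′` cannot coexist over the admissible `σ`
  exact (hβc L ι H T hT hdef h2 h3 μ W σ hirr hsm hadm P P' hPc hP'c hfin hfin' M σK σ𝔤 hGK hirrM ⟨T₁, hT₁K, hT₁𝔤, hT₁0⟩ M' σK' σ𝔤' hGK' hirrM'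
    ⟨T₂, hT₂K, hT₂𝔤, hT₂0⟩ hne hne').elim

end Summit.HodgeConjecture.HodgeConjecture.Cruxes.H413.F0P3HodgeTypeRigidOfBetaOppAdmCot3

end
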